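import Mathlib
import Literature.Probability.LatticeModels.ModifiedSimonInequality
import Literature.Probability.LatticeModels.LoopO1
import HarnessLib

/-!
# The pair-split deletion identity for the high-temperature (`T`-join) expansion of the Ising model

Topic `Literature/Probability/LatticeModels` (librarian move 2026-08-16 of the gate-parked module
`Literature/Uncategorized/PairSplitDeletionIdentity.lean`; declarations byte-identical, only the
namespace — this directory's — is new; the old names remain as deprecated aliases). The objects are
the `T`-joins `tJoins`, loop-O(1) weights and free Ising correlations `isingCorr` of
`Literature/Probability/LatticeModels/LoopO1.lean` and `ModifiedSimonInequality.lean`.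

* `Literature.Probability.LatticeModels.PairSplitDeletionIdentity` — **(★) pair-split deletion
  identity** (finite graph, any `β ≥ 0`, zero field, `t = tanh β`): summing the depleted pair
  correlation against the sourced loop weights of ONE pair reproduces the four-source loop sum
  restricted to the split `01|23`,
  `Σ_{F₁ ∈ 𝒯₀₁(G), a₂,a₃ ∉ V(K_{a₀}F₁)} t^|F₁| ⟨σ_{a₂}σ_{a₃}⟩^free_{G ∖ V(K_{a₀}F₁)}
     = Σ_{F ∈ 𝒯_{0123}(G), a₂,a₃ ∉ V(K_{a₀}F)} t^|F|`.
* `Literature.Probability.LatticeModels.PairSplitDeletionIdentity_holds` — its PROOF (exploration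
  from a source / cluster decomposition of `T`-joins + the high-temperature expansion
  `⟨σ_A⟩^free_Λ = g_Λ(A)/g_Λ(∅)`, Duminil-Copin, *Lectures on the Ising and Potts models*, §2.2.1),
  helpers in the sub-namespace `PairSplitDeletion` (`Rch`, `clusterEdges`, `edeg`, `dVol`,
  `fibre_sum`, `sum_clean_eq_sum_fibres`, `pairSplit_identity`, `pairSplit_identity_fin4`).

Origin: support computation of the refuter of crux `StrandShadow` (summit
`CriticalPhenomena/Ising3DConformalLimit`), relocated by the gate (2026-08-15) out of
`Summits/CriticalPhenomena/Ising3DConformalLimit/Theorems/StrandShadow/Negative/PairSplitDeletion.lean`,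
which still imports the parked copy and re-proves `Literature.Uncategorized.PairSplitDeletionIdentity`
by the old name (it keeps compiling through the alias).
-/

namespace Literature.Probability.LatticeModels

open scoped BigOperators Classical
open Finset

/-- **(★) Pair-split deletion identity** (finite graph, any real `t`, zero field, `β` with
`tanh β = t` on the Ising side): summing the depleted pair correlation against the sourced loop
weights of ONE pair reproduces the four-source loop sum restricted to the split `01|23`:
`Σ_{F₁ ∈ 𝒯₀₁(G), a₂,a₃ ∉ V(K_{a₀}F₁)} t^|F₁| · ⟨σ_{a₂}σ_{a₃}⟩^free_{G, V ∖ V(K_{a₀}F₁)}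
   = Σ_{F ∈ 𝒯_{0123}(G), a₂,a₃ ∉ V(K_{a₀}F)} t^|F|`.
Proof sketch: `F₁ ↦ (K, R) = (edges of the a₀-component, the rest)` is a bijection onto
{connected `K ∋ a₀` with `∂K = {a₀,a₁}`, `V(K) ∌ a₂,a₃`} × {even subgraphs of `G[V ∖ V(K)]`}, so the
left side is `Σ_K t^|K| Z⁰(G[V∖V(K)]) · Z^{23}(G[V∖V(K)])/Z⁰(G[V∖V(K)]) = Σ_K t^|K| Z^{23}(G[V∖V(K)])`
(HT expansion `isingCorr_free_eq_hteSum_div` on the induced subgraph), and `(K, R') ↦ K ∪ R'`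
with `R' ∈ 𝒯₂₃(G[V∖V(K)])` is a bijection onto the right-hand index set.  Verified exhaustively on
K4, Q3, Q3+diag, 3×3+chord (rattack seat, shadow_exact.py) and on `Λ_N ⊂ ℤ³` by MC within errors
(j013016: T-join-side `s_clean` = spin-side `s_sym`).  Dimension-free; PROVED below
(`PairSplitDeletionIdentity_holds`, from `PairSplitDeletion.pairSplit_identity`). [folklore] -/
def PairSplitDeletionIdentity : Prop :=
  ∀ (V : Type) [Fintype V] [DecidableEq V] (G : SimpleGraph V) [DecidableRel G.Adj] (β : ℝ),
    0 ≤ β → ∀ a : Fin 4 → V, Function.Injective a →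
    (let t : ℝ := Real.tanh β
     let R : Finset (Sym2 V) → V → Prop := fun F v =>
       (SimpleGraph.fromEdgeSet (↑F : Set (Sym2 V))).Reachable (a 0) v
     (∑ F ∈ (tJoins G Set.univ {a 0, a 1}).filter (fun F => ¬ R F (a 2) ∧ ¬ R F (a 3)),
        t ^ F.card * isingCorr G (Finset.univ.filter fun v => ¬ R F v) β 0 .free {a 2, a 3})
      = ∑ F ∈ (tJoins G Set.univ (Finset.univ.image a)).filter (fun F => ¬ R F (a 2) ∧ ¬ R F (a 3)),
          t ^ F.card)

end Literature.Probability.LatticeModels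

/-!
## Proof of `PairSplitDeletionIdentity` (discharge `PairSplitDeletionIdentity_holds`)

The argument is the standard "exploration from a source" decomposition of the high-temperature
(`T`-join) expansion, ported verbatim from the sorry-free Summits-side support files
`Summits/CriticalPhenomena/Ising3DConformalLimit/Theorems/StrandShadow/Negative/{ClusterDecomposition,
PairSplitDeletion}.lean` (Literature may not import Summits, CONVENTIONS §2), helpers in the
sub-namespace `Literature.Probability.LatticeModels.PairSplitDeletion`:

1. `Rch F x v` (reachability inside an edge finset), `clusterEdges F x` (edges of the `x`-component),
   `edeg F v` (degree), the handshake `even_card_odd_edeg`, the depleted volume `dVol K x`.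
2. **Fibre bijection** `fibre_sum`: over a fixed self-clustered `K` with odd set `S₀` and terminals
   `T ⊆ dVol K x`, `F ↦ F ∖ K` maps `{F ∈ 𝒯_{S₀ ∪ T}(G) : clusterEdges F x = K}` bijectively onto
   `{R ⊆ edgesIn G (dVol K x) : oddVerts (dVol K x) R = T}`, inverse `R ↦ K ∪ R`.
3. **Assembly**: both sides of (★) decompose over the cluster index set (`sum_clean_eq_sum_fibres`);
   each fibre is `t^|K| · g_{dVol K}({a₂,a₃})` — on the pair side by the high-temperature expansion
   `⟨σ_A⟩^free_Λ = g_Λ(A)/g_Λ(∅)` (Duminil-Copin, lectures on the Ising and Potts models, §2.2.1;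
   `isingCorr_free_eq_hteSum_div`), on the four-source side by `fibre_sum` with `T = {a₂,a₃}`.
4. `pairSplit_identity_fin4` dresses (★) in the fact's `Fin 4` costume; the fact's hypotheses
   `0 ≤ β` and `Function.Injective a` are not needed.
-/

noncomputable section

namespace Literature.Probability.LatticeModels.PairSplitDeletion

open scoped BigOperators Classical
open Finset

/-! ### Reachability, clusters and degrees inside an edge finset -/

section Graph
variable {V : Type*} [DecidableEq V]

/-- Reachability from `x` inside the edge finset `F`. [folklore] -/
abbrev Rch (F : Finset (Sym2 V)) (x v : V) : Prop :=
  (SimpleGraph.fromEdgeSet (↑F : Set (Sym2 V))).Reachable x v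

omit [DecidableEq V] in
/-- Every vertex is reachable from itself inside any edge set. [folklore] -/
theorem rch_refl (F : Finset (Sym2 V)) (x : V) : Rch F x x := SimpleGraph.Reachable.refl x

omit [DecidableEq V] in
/-- Reachability inside an edge set is monotone in the edge set. [folklore] -/
theorem rch_mono {F F' : Finset (Sym2 V)} (h : F ⊆ F') {x v : V} (hr : Rch F x v) : Rch F' x v :=
  SimpleGraph.Reachable.mono (SimpleGraph.fromEdgeSet_mono (Finset.coe_subset.2 h)) hr

/-- One more edge of `F` at a reachable endpoint keeps the other endpoint reachable. [folklore] -/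
theorem rch_step {F : Finset (Sym2 V)} {x u v : V} {e : Sym2 V} (he : e ∈ F) (hu : u ∈ e)
    (hv : v ∈ e) (hxu : Rch F x u) : Rch F x v := by
  by_cases huv : u = v
  · exact huv ▸ hxu
  · have hadj : (SimpleGraph.fromEdgeSet (↑F : Set (Sym2 V))).Adj u v := by
      rw [SimpleGraph.fromEdgeSet_adj]
      refine ⟨?_, huv⟩
      have : e = s(u, v) := (Sym2.mem_and_mem_iff huv).1 ⟨hu, hv⟩
      rw [← this]
      exact Finset.mem_coe.2 he
    exact SimpleGraph.Reachable.trans hxu hadj.reachable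

/-- Adding edges none of whose endpoints is `K`-reachable from `x` does not change what is
reachable from `x`. [folklore] -/
theorem rch_union_iff {K R : Finset (Sym2 V)} {x : V} (hR : ∀ e ∈ R, ∀ v ∈ e, ¬ Rch K x v)
    (v : V) : Rch (K ∪ R) x v ↔ Rch K x v := by
  refine ⟨fun h => ?_, rch_mono subset_union_left⟩
  unfold Rch at h
  rw [SimpleGraph.reachable_iff_reflTransGen] at h
  induction h with
  | refl => exact rch_refl K x
  | tail _ hbc ih =>
    rw [SimpleGraph.fromEdgeSet_adj] at hbc
    obtain ⟨hmem, _⟩ := hbc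
    rcases Finset.mem_union.1 (Finset.mem_coe.1 hmem) with hK | hRR
    · exact rch_step hK (Sym2.mem_mk_left _ _) (Sym2.mem_mk_right _ _) ih
    · exact absurd ih (hR _ hRR _ (Sym2.mem_mk_left _ _))

/-- The edges of `F` in the `F`-component of `x` (both endpoints reachable; one suffices). [folklore] -/
def clusterEdges (F : Finset (Sym2 V)) (x : V) : Finset (Sym2 V) :=
  F.filter fun e => ∃ v ∈ e, Rch F x v

omit [DecidableEq V] in
/-- The cluster edges are edges of `F`. [folklore] -/
theorem clusterEdges_subset (F : Finset (Sym2 V)) (x : V) : clusterEdges F x ⊆ F :=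
  filter_subset _ _

/-- Edges of `F` outside the `x`-cluster touch no vertex reachable from `x`. [folklore] -/
theorem sdiff_clusterEdges_avoid (F : Finset (Sym2 V)) (x : V) :
    ∀ e ∈ F \ clusterEdges F x, ∀ v ∈ e, ¬ Rch (clusterEdges F x) x v := by
  intro e he v hv hr
  rw [mem_sdiff, clusterEdges, mem_filter] at he
  exact he.2 ⟨he.1, v, hv, rch_mono (clusterEdges_subset F x) hr⟩

/-- Reachability from `x` inside the `x`-cluster edges is reachability inside `F`. [folklore] -/
theorem rch_clusterEdges_iff (F : Finset (Sym2 V)) (x v : V) :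
    Rch (clusterEdges F x) x v ↔ Rch F x v := by
  have h := rch_union_iff (sdiff_clusterEdges_avoid F x) v
  rw [union_sdiff_of_subset (clusterEdges_subset F x)] at h
  exact h.symm

/-- Taking cluster edges is idempotent (the `x`-cluster is self-clustered). [folklore] -/
theorem clusterEdges_idem (F : Finset (Sym2 V)) (x : V) :
    clusterEdges (clusterEdges F x) x = clusterEdges F x := by
  ext e
  constructor
  · intro h
    exact (mem_filter.1 h).1
  · intro h
    have h' := h
    rw [clusterEdges, mem_filter] at h'
    obtain ⟨_, v, hv, hr⟩ := h'
    exact mem_filter.2 ⟨h, v, hv, (rch_clusterEdges_iff F x v).2 hr⟩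

/-- Adding edges that avoid the reachable set does not change a self-clustered `K`. [folklore] -/
theorem clusterEdges_union_eq {K R : Finset (Sym2 V)} {x : V} (hK : clusterEdges K x = K)
    (hR : ∀ e ∈ R, ∀ v ∈ e, ¬ Rch K x v) : clusterEdges (K ∪ R) x = K := by
  ext e
  rw [clusterEdges, mem_filter, mem_union]
  simp_rw [rch_union_iff hR]
  constructor
  · rintro ⟨hKR | hRR, v, hv, hr⟩
    · exact hKR
    · exact absurd hr (hR e hRR v hv)
  · intro he
    refine ⟨Or.inl he, ?_⟩
    have he' : e ∈ clusterEdges K x := by rw [hK]; exact he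
    exact (mem_filter.1 he').2

/-- Every endpoint of an edge of a self-clustered `K` is reachable. [folklore] -/
theorem rch_of_mem_of_self {K : Finset (Sym2 V)} {x : V} (hK : clusterEdges K x = K)
    {e : Sym2 V} (he : e ∈ K) {v : V} (hv : v ∈ e) : Rch K x v := by
  have he' : e ∈ clusterEdges K x := by rw [hK]; exact he
  obtain ⟨-, u, hu, hxu⟩ := mem_filter.1 he'
  exact rch_step he hu hv hxu

/-- `F`-degree of a vertex in an edge finset. [folklore] -/
def edeg (F : Finset (Sym2 V)) (v : V) : ℕ := #(F.filter fun e => v ∈ e)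

/-- Degrees add over disjoint edge sets. [folklore] -/
theorem edeg_union {K R : Finset (Sym2 V)} (h : Disjoint K R) (v : V) :
    edeg (K ∪ R) v = edeg K v + edeg R v := by
  unfold edeg
  rw [filter_union, card_union_of_disjoint (disjoint_filter_filter h)]

/-- A vertex on no edge of `R` has `R`-degree `0`. [folklore] -/
theorem edeg_eq_zero_of_avoid {R : Finset (Sym2 V)} {v : V} (h : ∀ e ∈ R, v ∉ e) : edeg R v = 0 := by
  unfold edeg
  rw [card_eq_zero, filter_eq_empty_iff]
  exact fun e he => h e he

/-- In a self-clustered `K`, unreachable vertices have `K`-degree `0`. [folklore] -/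
theorem edeg_eq_zero_of_not_rch {K : Finset (Sym2 V)} {x v : V} (hK : clusterEdges K x = K)
    (hv : ¬ Rch K x v) : edeg K v = 0 :=
  edeg_eq_zero_of_avoid fun _ he hve => hv (rch_of_mem_of_self hK he hve)

/-- In a self-clustered `K`, vertices of positive `K`-degree are reachable. [folklore] -/
theorem rch_of_edeg_ne_zero {K : Finset (Sym2 V)} {x v : V} (hK : clusterEdges K x = K)
    (hv : edeg K v ≠ 0) : Rch K x v := by
  by_contra h
  exact hv (edeg_eq_zero_of_not_rch hK h)

/-- A self-clustered `K` is disjoint from any edge set avoiding its reachable vertices. [folklore] -/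
theorem disjoint_of_avoid {K R : Finset (Sym2 V)} {x : V} (hK : clusterEdges K x = K)
    (hR : ∀ e ∈ R, ∀ v ∈ e, ¬ Rch K x v) : Disjoint K R := by
  rw [Finset.disjoint_left]
  intro e heK heR
  induction e using Sym2.ind with
  | _ a b => exact hR _ heR a (Sym2.mem_mk_left a b) (rch_of_mem_of_self hK heK (Sym2.mem_mk_left a b))

/-- Handshake: an edge finset without diagonal edges has an even number of odd vertices. [folklore] -/
theorem even_card_odd_edeg [Fintype V] {F : Finset (Sym2 V)} (hdiag : ∀ e ∈ F, ¬ e.IsDiag) :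
    Even #(univ.filter fun v => Odd (edeg F v)) := by
  have htwo : ∀ e ∈ F, (Finset.univ.filter fun v : V => v ∈ e).card = 2 := by
    intro e he
    induction e using Sym2.ind with
    | _ a b =>
      have hab : a ≠ b := fun h => hdiag _ he (by simp [h])
      rw [Finset.card_eq_two]
      exact ⟨a, b, hab, by ext v; simp [Sym2.mem_iff]⟩
  have hsum : ∑ v, edeg F v = 2 * F.card := by
    unfold edeg
    simp_rw [Finset.card_filter]
    rw [Finset.sum_comm]
    simp_rw [← Finset.card_filter]
    rw [Finset.sum_congr rfl htwo, Finset.sum_const, smul_eq_mul, mul_comm]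
  have heven : Even (∑ v, edeg F v) := ⟨F.card, by rw [hsum]; ring⟩
  rwa [Finset.even_sum_iff_even_card_odd] at heven
end Graph

/-! ### The fibre bijection `F ↦ F ∖ K`, `R ↦ K ∪ R` over a fixed self-clustered `K` -/

section Fibre
variable {V : Type*} [Fintype V] [DecidableEq V] (G : SimpleGraph V) [DecidableRel G.Adj]

/-- Depleted volume: vertices not `K`-reachable from `x`. [folklore] -/
def dVol (K : Finset (Sym2 V)) (x : V) : Finset V := univ.filter fun v => ¬ Rch K x v

/-- Membership in the depleted volume: not reachable from `x` inside `K`. [folklore] -/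
theorem mem_dVol {K : Finset (Sym2 V)} {x v : V} : v ∈ dVol K x ↔ ¬ Rch K x v := by
  simp [dVol]

/-- Adding edges that avoid the reachable set does not change the depleted volume. [folklore] -/
theorem dVol_union_eq {K R : Finset (Sym2 V)} {x : V} (hR : ∀ e ∈ R, ∀ v ∈ e, ¬ Rch K x v) :
    dVol (K ∪ R) x = dVol K x := by
  ext v; simp only [dVol, mem_filter, mem_univ, true_and, rch_union_iff hR]

/-- `tJoins G univ S` membership in terms of `edeg`. [folklore] -/
theorem mem_tJoins_univ {S : Finset V} {F : Finset (Sym2 V)} :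
    F ∈ tJoins G Set.univ S ↔ F ⊆ G.edgeFinset ∧ ∀ v, Odd (edeg F v) ↔ v ∈ S := by
  rw [mem_tJoins]
  simp only [Set.subset_univ, true_and]
  rfl

/-- **Fibre sum.** Fix a self-clustered `K ⊆ E(G)` at `x` with odd set `S₀` and a terminal set
`T` inside the depleted volume `Λ = dVol K x`.  Then `F ↦ F ∖ K` is a bijection from
`{F ∈ 𝒯_{S₀ ∪ T}(G) : clusterEdges F x = K}` onto `{R ⊆ edgesIn G Λ : oddVerts Λ R = T}`, with
inverse `R ↦ K ∪ R`. [folklore] -/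
theorem fibre_sum {K : Finset (Sym2 V)} {x : V} {S₀ T : Finset V} (hKG : K ⊆ G.edgeFinset)
    (hKself : clusterEdges K x = K) (hKodd : ∀ v, Odd (edeg K v) ↔ v ∈ S₀)
    (hT : T ⊆ dVol K x) (g : Finset (Sym2 V) → ℝ) :
    ∑ F ∈ (tJoins G Set.univ (S₀ ∪ T)).filter (fun F => clusterEdges F x = K), g F =
      ∑ R ∈ (edgesIn G (dVol K x)).powerset.filter (fun R => oddVerts (dVol K x) R = T),
        g (K ∪ R) := by
  -- vertices of S₀ are reachable
  have hS₀ : ∀ v ∈ S₀, Rch K x v := fun v hv =>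
    rch_of_edeg_ne_zero hKself (fun h0 => by
      have := (hKodd v).2 hv; rw [h0] at this; exact Nat.not_odd_zero this)
  refine Finset.sum_bij' (fun F _ => F \ K) (fun R _ => K ∪ R) ?_ ?_ ?_ ?_ ?_
  · -- hi : F ↦ F \ K lands in the even/T-subgraphs of the depleted volume
    intro F hF
    rw [mem_filter] at hF
    obtain ⟨hF, hcl⟩ := hF
    rw [mem_tJoins_univ] at hF
    obtain ⟨hFG, hFodd⟩ := hF
    have havoid : ∀ e ∈ F \ K, ∀ v ∈ e, ¬ Rch K x v := by
      have := sdiff_clusterEdges_avoid F x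
      rw [hcl] at this
      exact this
    have hdisj : Disjoint K (F \ K) := disjoint_sdiff
    have hKF : K ⊆ F := by rw [← hcl]; exact clusterEdges_subset F x
    rw [mem_filter, mem_powerset]
    refine ⟨fun e he => ?_, ?_⟩
    · rw [mem_edgesIn_iff]
      refine ⟨SimpleGraph.mem_edgeFinset.1 (hFG (mem_sdiff.1 he).1), fun v hv => ?_⟩
      exact mem_dVol.2 (havoid e he v hv)
    · ext v
      rw [oddVerts, mem_filter, mem_dVol]
      constructor
      · rintro ⟨hv, hodd⟩
        have hdeg : edeg F v = edeg K v + edeg (F \ K) v := by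
          rw [← edeg_union hdisj, union_sdiff_of_subset hKF]
        rw [edeg_eq_zero_of_not_rch hKself hv, zero_add] at hdeg
        have hodd' : Odd (edeg F v) := by rw [hdeg]; exact hodd
        have hvS := (hFodd v).1 hodd'
        rcases mem_union.1 hvS with h | h
        · exact absurd (hS₀ v h) hv
        · exact h
      · intro hvT
        have hv : ¬ Rch K x v := mem_dVol.1 (hT hvT)
        refine ⟨hv, ?_⟩
        have hdeg : edeg F v = edeg K v + edeg (F \ K) v := by
          rw [← edeg_union hdisj, union_sdiff_of_subset hKF]
        rw [edeg_eq_zero_of_not_rch hKself hv, zero_add] at hdeg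
        have h1 : Odd (edeg F v) := (hFodd v).2 (mem_union_right _ hvT)
        rw [hdeg] at h1
        exact h1
  · -- hj : R ↦ K ∪ R lands in the fibre
    intro R hR
    rw [mem_filter, mem_powerset] at hR
    obtain ⟨hRE, hRodd⟩ := hR
    have havoid : ∀ e ∈ R, ∀ v ∈ e, ¬ Rch K x v := fun e he v hv =>
      mem_dVol.1 ((mem_edgesIn_iff.1 (hRE he)).2 v hv)
    have hdisj : Disjoint K R := by
      rw [Finset.disjoint_left]
      intro e heK heR
      induction e using Sym2.ind with
      | _ a b => exact havoid _ heR a (Sym2.mem_mk_left a b) (rch_of_mem_of_self hKself heK (Sym2.mem_mk_left a b))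
    rw [mem_filter, mem_tJoins_univ]
    refine ⟨⟨?_, fun v => ?_⟩, clusterEdges_union_eq hKself havoid⟩
    · intro e he
      rcases mem_union.1 he with h | h
      · exact hKG h
      · exact SimpleGraph.mem_edgeFinset.2 (mem_edgesIn_iff.1 (hRE h)).1
    · rw [edeg_union hdisj]
      by_cases hv : Rch K x v
      · have h0 : edeg R v = 0 := edeg_eq_zero_of_avoid fun e he hve => havoid e he v hve hv
        rw [h0, add_zero, hKodd v, mem_union]
        constructor
        · exact Or.inl
        · rintro (h | h)
          · exact h
          · exact absurd hv (mem_dVol.1 (hT h))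
      · rw [edeg_eq_zero_of_not_rch hKself hv, zero_add, mem_union]
        have hvΛ : v ∈ dVol K x := mem_dVol.2 hv
        have key : Odd (edeg R v) ↔ v ∈ T := by
          rw [← hRodd, oddVerts, mem_filter]
          exact ⟨fun h => ⟨hvΛ, h⟩, fun h => h.2⟩
        rw [key]
        constructor
        · exact Or.inr
        · rintro (h | h)
          · exact absurd (hS₀ v h) hv
          · exact h
  · -- left inverse
    intro F hF
    rw [mem_filter] at hF
    have hKF : K ⊆ F := by rw [← hF.2]; exact clusterEdges_subset F x
    exact union_sdiff_of_subset hKF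
  · -- right inverse
    intro R hR
    rw [mem_filter, mem_powerset] at hR
    have havoid : ∀ e ∈ R, ∀ v ∈ e, ¬ Rch K x v := fun e he v hv =>
      mem_dVol.1 ((mem_edgesIn_iff.1 (hR.1 he)).2 v hv)
    have hdisj : Disjoint K R := by
      rw [Finset.disjoint_left]
      intro e heK heR
      induction e using Sym2.ind with
      | _ a b => exact havoid _ heR a (Sym2.mem_mk_left a b) (rch_of_mem_of_self hKself heK (Sym2.mem_mk_left a b))
    exact union_sdiff_cancel_left hdisj
  · -- summand
    intro F hF
    rw [mem_filter] at hF
    have hKF : K ⊆ F := by rw [← hF.2]; exact clusterEdges_subset F x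
    rw [union_sdiff_of_subset hKF]
end Fibre

/-! ### The cluster index set -/

section Vocabulary
variable {V : Type*} [Fintype V] [DecidableEq V] (G : SimpleGraph V) [DecidableRel G.Adj]

/-- The cluster index set: self-clustered `K ⊆ E(G)` at `a₀` with odd set `{a₀, a₁}`, reaching
neither `a₂` nor `a₃`. [folklore] -/
def clusterIndex (a₀ a₁ a₂ a₃ : V) : Finset (Finset (Sym2 V)) :=
  (G.edgeFinset.powerset).filter fun K => clusterEdges K a₀ = K ∧
    (∀ v, Odd (edeg K v) ↔ v ∈ ({a₀, a₁} : Finset V)) ∧ ¬ Rch K a₀ a₂ ∧ ¬ Rch K a₀ a₃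

/-- Membership in the cluster index set, unfolded. [folklore] -/
theorem mem_clusterIndex {a₀ a₁ a₂ a₃ : V} {K : Finset (Sym2 V)} :
    K ∈ clusterIndex G a₀ a₁ a₂ a₃ ↔ K ⊆ G.edgeFinset ∧ clusterEdges K a₀ = K ∧
      (∀ v, Odd (edeg K v) ↔ v ∈ ({a₀, a₁} : Finset V)) ∧ ¬ Rch K a₀ a₂ ∧ ¬ Rch K a₀ a₃ := by
  rw [clusterIndex, mem_filter, mem_powerset]

end Vocabulary

/-! ### Assembly of (★) -/

section Assembly

variable {V : Type*} [Fintype V] [DecidableEq V] (G : SimpleGraph V) [DecidableRel G.Adj]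


omit [Fintype V] in
/-- Parity transfer between `F` and its `a₀`-cluster at a reachable vertex. [folklore] -/
theorem odd_edeg_clusterEdges_iff {F : Finset (Sym2 V)} {a₀ v : V} (hv : Rch F a₀ v) :
    Odd (edeg (clusterEdges F a₀) v) ↔ Odd (edeg F v) := by
  have hsplit : edeg F v = edeg (clusterEdges F a₀) v + edeg (F \ clusterEdges F a₀) v := by
    rw [← edeg_union disjoint_sdiff, union_sdiff_of_subset (clusterEdges_subset F a₀)]
  have h0 : edeg (F \ clusterEdges F a₀) v = 0 :=
    edeg_eq_zero_of_avoid fun e he hve =>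
      sdiff_clusterEdges_avoid F a₀ e he v hve ((rch_clusterEdges_iff F a₀ v).2 hv)
  rw [hsplit, h0, add_zero]

omit [Fintype V] in
/-- Unreachable vertices have degree `0` in the `a₀`-cluster. [folklore] -/
theorem edeg_clusterEdges_eq_zero {F : Finset (Sym2 V)} {a₀ v : V} (hv : ¬ Rch F a₀ v) :
    edeg (clusterEdges F a₀) v = 0 :=
  edeg_eq_zero_of_not_rch (clusterEdges_idem F a₀) (by rwa [rch_clusterEdges_iff])

/-- In a `T`-join whose terminals other than `a₀, a₁` are unreachable from `a₀`, the terminal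
`a₁` IS reachable (handshake inside the `a₀`-cluster). [folklore] -/
theorem rch_a1 {S' : Finset V} {a₀ a₁ : V} (ha₀ : a₀ ∈ S') {F : Finset (Sym2 V)}
    (hS' : ∀ v ∈ S', Rch F a₀ v → v = a₀ ∨ v = a₁)
    (hF : F ∈ tJoins G Set.univ S') : Rch F a₀ a₁ := by
  by_contra hn
  rw [mem_tJoins_univ] at hF
  obtain ⟨hFG, hFodd⟩ := hF
  set K := clusterEdges F a₀ with hKdef
  have hdiag : ∀ e ∈ K, ¬ e.IsDiag := fun e he =>
    SimpleGraph.not_isDiag_of_mem_edgeSet G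
      (SimpleGraph.mem_edgeFinset.1 (hFG (clusterEdges_subset F a₀ he)))
  have heven := even_card_odd_edeg hdiag
  have hO : (univ.filter fun v => Odd (edeg K v)) = {a₀} := by
    ext v
    simp only [mem_filter, mem_univ, true_and, mem_singleton]
    by_cases hv : Rch F a₀ v
    · rw [hKdef, odd_edeg_clusterEdges_iff hv, hFodd v]
      constructor
      · intro hvS
        rcases hS' v hvS hv with h | h
        · exact h
        · exact absurd (h ▸ hv) hn
      · rintro rfl; exact ha₀
    · rw [hKdef, edeg_clusterEdges_eq_zero hv]
      constructor
      · intro h; exact absurd h Nat.not_odd_zero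
      · rintro rfl; exact absurd (rch_refl F v) hv
  rw [hO, card_singleton] at heven
  exact Nat.not_even_one heven

/-- The `a₀`-cluster of a clean `T`-join lies in the cluster index set. [folklore] -/
theorem clusterEdges_mem_clusterIndex {S' : Finset V} {a₀ a₁ a₂ a₃ : V}
    (ha₀ : a₀ ∈ S') (ha₁ : a₁ ∈ S') (hS' : ∀ v ∈ S', v ≠ a₀ → v ≠ a₁ → v = a₂ ∨ v = a₃)
    {F : Finset (Sym2 V)} (hF : F ∈ tJoins G Set.univ S') (h2 : ¬ Rch F a₀ a₂)
    (h3 : ¬ Rch F a₀ a₃) : clusterEdges F a₀ ∈ clusterIndex G a₀ a₁ a₂ a₃ := by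
  have hreach : ∀ v ∈ S', Rch F a₀ v → v = a₀ ∨ v = a₁ := by
    intro v hv hr
    by_cases h0 : v = a₀
    · exact Or.inl h0
    by_cases h1 : v = a₁
    · exact Or.inr h1
    rcases hS' v hv h0 h1 with rfl | rfl
    · exact absurd hr h2
    · exact absurd hr h3
  have h1 : Rch F a₀ a₁ := rch_a1 G ha₀ hreach hF
  have hF' := hF
  rw [mem_tJoins_univ] at hF'
  obtain ⟨hFG, hFodd⟩ := hF'
  rw [mem_clusterIndex]
  refine ⟨(clusterEdges_subset F a₀).trans hFG, clusterEdges_idem F a₀, fun v => ?_, ?_, ?_⟩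
  · by_cases hv : Rch F a₀ v
    · rw [odd_edeg_clusterEdges_iff hv, hFodd v, mem_insert, mem_singleton]
      exact ⟨fun hvS => hreach v hvS hv, fun h => h.elim (fun h => h ▸ ha₀) (fun h => h ▸ ha₁)⟩
    · rw [edeg_clusterEdges_eq_zero hv, mem_insert, mem_singleton]
      constructor
      · intro h; exact absurd h Nat.not_odd_zero
      · rintro (rfl | rfl)
        · exact absurd (rch_refl F v) hv
        · exact absurd h1 hv
  · rwa [rch_clusterEdges_iff]
  · rwa [rch_clusterEdges_iff]

/-- **Outer decomposition**: a clean sum over `T`-joins is a sum over the cluster index set of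
fibre sums. [folklore] -/
theorem sum_clean_eq_sum_fibres {S' : Finset V} {a₀ a₁ a₂ a₃ : V}
    (ha₀ : a₀ ∈ S') (ha₁ : a₁ ∈ S') (hS' : ∀ v ∈ S', v ≠ a₀ → v ≠ a₁ → v = a₂ ∨ v = a₃)
    (g : Finset (Sym2 V) → ℝ) :
    ∑ F ∈ (tJoins G Set.univ S').filter (fun F => ¬ Rch F a₀ a₂ ∧ ¬ Rch F a₀ a₃), g F =
      ∑ K ∈ clusterIndex G a₀ a₁ a₂ a₃,
        ∑ F ∈ (tJoins G Set.univ S').filter (fun F => clusterEdges F a₀ = K), g F := by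
  have hmaps : ∀ F ∈ (tJoins G Set.univ S').filter (fun F => ¬ Rch F a₀ a₂ ∧ ¬ Rch F a₀ a₃),
      clusterEdges F a₀ ∈ clusterIndex G a₀ a₁ a₂ a₃ := by
    intro F hF
    rw [mem_filter] at hF
    exact clusterEdges_mem_clusterIndex G ha₀ ha₁ hS' hF.1 hF.2.1 hF.2.2
  rw [← Finset.sum_fiberwise_of_maps_to hmaps g]
  refine Finset.sum_congr rfl fun K hK => ?_
  apply Finset.sum_congr ?_ (fun _ _ => rfl)
  obtain ⟨-, -, -, hK2, hK3⟩ := (mem_clusterIndex G).1 hK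
  ext F
  simp only [mem_filter]
  constructor
  · rintro ⟨⟨hF, -⟩, hcl⟩; exact ⟨hF, hcl⟩
  · rintro ⟨hF, hcl⟩
    refine ⟨⟨hF, ?_, ?_⟩, hcl⟩
    · rw [← rch_clusterEdges_iff, hcl]; exact hK2
    · rw [← rch_clusterEdges_iff, hcl]; exact hK3

/-- **Fibre evaluation, pair side**: over the fibre of `K`, `Σ t^|F| ⟨σ₂σ₃⟩_{depl F} = t^|K| · g_Λ({a₂,a₃})`. [folklore] -/
theorem fibre_pair_side {a₀ a₁ a₂ a₃ : V} {K : Finset (Sym2 V)}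
    (hK : K ∈ clusterIndex G a₀ a₁ a₂ a₃) (β : ℝ) :
    ∑ F ∈ (tJoins G Set.univ {a₀, a₁}).filter (fun F => clusterEdges F a₀ = K),
        Real.tanh β ^ F.card * isingCorr G (dVol F a₀) β 0 .free {a₂, a₃} =
      Real.tanh β ^ K.card * hteSum G (dVol K a₀) (Real.tanh β) {a₂, a₃} := by
  obtain ⟨hKG, hKself, hKodd, hK2, hK3⟩ := (mem_clusterIndex G).1 hK
  have hfib := fibre_sum G hKG hKself hKodd (T := ∅) (empty_subset _)
    (fun F => Real.tanh β ^ F.card * isingCorr G (dVol F a₀) β 0 .free {a₂, a₃})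
  rw [union_empty] at hfib
  rw [hfib]
  set Λ := dVol K a₀ with hΛ
  have hA : ({a₂, a₃} : Finset V) ⊆ Λ := by
    intro v hv
    rw [mem_insert, mem_singleton] at hv
    rcases hv with rfl | rfl
    · exact mem_dVol.2 hK2
    · exact mem_dVol.2 hK3
  have hne : hteSum G Λ (Real.tanh β) ∅ ≠ 0 := (hteSum_empty_pos G Λ β).ne'
  have hsummand : ∀ R ∈ (edgesIn G Λ).powerset.filter (fun R => oddVerts Λ R = ∅),
      Real.tanh β ^ (K ∪ R).card * isingCorr G (dVol (K ∪ R) a₀) β 0 .free {a₂, a₃} =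
        Real.tanh β ^ K.card * (hteSum G Λ (Real.tanh β) {a₂, a₃} / hteSum G Λ (Real.tanh β) ∅) *
          Real.tanh β ^ R.card := by
    intro R hR
    rw [mem_filter, mem_powerset] at hR
    have havoid : ∀ e ∈ R, ∀ v ∈ e, ¬ Rch K a₀ v := fun e he v hv =>
      mem_dVol.1 ((mem_edgesIn_iff.1 (hR.1 he)).2 v hv)
    rw [dVol_union_eq havoid, card_union_of_disjoint (disjoint_of_avoid hKself havoid), pow_add,
      ← hΛ, isingCorr_free_eq_hteSum_div G Λ β hA]
    ring
  rw [Finset.sum_congr rfl hsummand, ← Finset.mul_sum]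
  have hZ : ∑ R ∈ (edgesIn G Λ).powerset.filter (fun R => oddVerts Λ R = ∅), Real.tanh β ^ R.card =
      hteSum G Λ (Real.tanh β) ∅ := rfl
  rw [hZ]
  field_simp

/-- **Fibre evaluation, four-source side**: `Σ t^|F| = t^|K| · g_Λ({a₂,a₃})`. [folklore] -/
theorem fibre_four_side {a₀ a₁ a₂ a₃ : V} {K : Finset (Sym2 V)}
    (hK : K ∈ clusterIndex G a₀ a₁ a₂ a₃) (t : ℝ) :
    ∑ F ∈ (tJoins G Set.univ ({a₀, a₁} ∪ {a₂, a₃})).filter (fun F => clusterEdges F a₀ = K),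
        t ^ F.card = t ^ K.card * hteSum G (dVol K a₀) t {a₂, a₃} := by
  obtain ⟨hKG, hKself, hKodd, hK2, hK3⟩ := (mem_clusterIndex G).1 hK
  have hT : ({a₂, a₃} : Finset V) ⊆ dVol K a₀ := by
    intro v hv
    rw [mem_insert, mem_singleton] at hv
    rcases hv with rfl | rfl
    · exact mem_dVol.2 hK2
    · exact mem_dVol.2 hK3
  rw [fibre_sum G hKG hKself hKodd hT (fun F => t ^ F.card)]
  have hsummand : ∀ R ∈ (edgesIn G (dVol K a₀)).powerset.filter (fun R => oddVerts (dVol K a₀) R = {a₂, a₃}),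
      t ^ (K ∪ R).card = t ^ K.card * t ^ R.card := by
    intro R hR
    rw [mem_filter, mem_powerset] at hR
    have havoid : ∀ e ∈ R, ∀ v ∈ e, ¬ Rch K a₀ v := fun e he v hv =>
      mem_dVol.1 ((mem_edgesIn_iff.1 (hR.1 he)).2 v hv)
    rw [card_union_of_disjoint (disjoint_of_avoid hKself havoid), pow_add]
  rw [Finset.sum_congr rfl hsummand, ← Finset.mul_sum]
  rfl

/-- **(★), abstract form.** [folklore] -/
theorem pairSplit_identity (a₀ a₁ a₂ a₃ : V) (β : ℝ) :
    ∑ F ∈ (tJoins G Set.univ {a₀, a₁}).filter (fun F => ¬ Rch F a₀ a₂ ∧ ¬ Rch F a₀ a₃),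
        Real.tanh β ^ F.card * isingCorr G (dVol F a₀) β 0 .free {a₂, a₃} =
      ∑ F ∈ (tJoins G Set.univ ({a₀, a₁} ∪ {a₂, a₃})).filter (fun F => ¬ Rch F a₀ a₂ ∧ ¬ Rch F a₀ a₃),
        Real.tanh β ^ F.card := by
  have hS₁ : ∀ v ∈ ({a₀, a₁} : Finset V), v ≠ a₀ → v ≠ a₁ → v = a₂ ∨ v = a₃ := by
    intro v hv h0 h1
    rw [mem_insert, mem_singleton] at hv
    rcases hv with rfl | rfl
    · exact absurd rfl h0
    · exact absurd rfl h1
  have hS₂ : ∀ v ∈ ({a₀, a₁} ∪ {a₂, a₃} : Finset V), v ≠ a₀ → v ≠ a₁ → v = a₂ ∨ v = a₃ := by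
    intro v hv h0 h1
    rw [mem_union, mem_insert, mem_singleton, mem_insert, mem_singleton] at hv
    rcases hv with (rfl | rfl) | h
    · exact absurd rfl h0
    · exact absurd rfl h1
    · exact h
  rw [sum_clean_eq_sum_fibres G (by simp) (by simp) hS₁,
    sum_clean_eq_sum_fibres G (by simp) (by simp) hS₂]
  refine Finset.sum_congr rfl fun K hK => ?_
  rw [fibre_pair_side G hK, fibre_four_side G hK]

end Assembly

/-! ### (★) in the `Fin 4` dress of `PairSplitDeletionIdentity` -/

section Dress

variable {V : Type*} [Fintype V] [DecidableEq V] (G : SimpleGraph V) [DecidableRel G.Adj]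

/-- **(★) in the `Fin 4` dress of `PairSplitDeletionIdentity`**: for `a : Fin 4 → V` and real `β`
(`t = tanh β`),
`Σ_{F ∈ 𝒯₀₁(G), a₂,a₃ ∉ V(K_{a₀}F)} t^|F| · ⟨σ_{a₂}σ_{a₃}⟩^free_{G, V ∖ V(K_{a₀}F)}
   = Σ_{F ∈ 𝒯_{image a}(G), a₂,a₃ ∉ V(K_{a₀}F)} t^|F|` — the configurations of ONE sourced
strand, weighted by the depleted free pair correlation of the other pair, are the four-source
configurations split as `01|23`.  (No injectivity or sign hypothesis is needed; `dVol F (a 0)` is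
written out as the `Finset.univ.filter` of the fact.) [folklore] -/
theorem pairSplit_identity_fin4 (β : ℝ) (a : Fin 4 → V) :
    (∑ F ∈ (tJoins G Set.univ {a 0, a 1}).filter (fun F : Finset (Sym2 V) =>
        ¬ (SimpleGraph.fromEdgeSet (↑F : Set (Sym2 V))).Reachable (a 0) (a 2) ∧
        ¬ (SimpleGraph.fromEdgeSet (↑F : Set (Sym2 V))).Reachable (a 0) (a 3)),
        Real.tanh β ^ F.card * isingCorr G (Finset.univ.filter fun v : V =>
          ¬ (SimpleGraph.fromEdgeSet (↑F : Set (Sym2 V))).Reachable (a 0) v) β 0 .free {a 2, a 3})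
      = ∑ F ∈ (tJoins G Set.univ (Finset.univ.image a)).filter (fun F : Finset (Sym2 V) =>
          ¬ (SimpleGraph.fromEdgeSet (↑F : Set (Sym2 V))).Reachable (a 0) (a 2) ∧
          ¬ (SimpleGraph.fromEdgeSet (↑F : Set (Sym2 V))).Reachable (a 0) (a 3)),
          Real.tanh β ^ F.card := by
  have himg : (Finset.univ.image a : Finset V) = {a 0, a 1} ∪ {a 2, a 3} := by
    ext v
    simp only [Finset.mem_image, Finset.mem_univ, true_and, Finset.mem_union, Finset.mem_insert,
      Finset.mem_singleton]
    constructor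
    · rintro ⟨i, rfl⟩
      fin_cases i <;> simp
    · rintro ((rfl | rfl) | (rfl | rfl)) <;> exact ⟨_, rfl⟩
  rw [himg]
  exact pairSplit_identity G (a 0) (a 1) (a 2) (a 3) β

end Dress

end Literature.Probability.LatticeModels.PairSplitDeletion

namespace Literature.Probability.LatticeModels

/-- **Discharge of `PairSplitDeletionIdentity`**: the pair-split deletion identity (★) holds on every
finite graph, for every real `β` and every `a : Fin 4 → V` (it is `PairSplitDeletion.pairSplit_identity_fin4`;
the fact's hypotheses `0 ≤ β` and injectivity of `a` are not used). [folklore] -/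
theorem PairSplitDeletionIdentity_holds : PairSplitDeletionIdentity := by
  intro V _ _ G _ β _ a _
  exact PairSplitDeletion.pairSplit_identity_fin4 G β a

end Literature.Probability.LatticeModels

end
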